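import Literature.MathematicalPhysics.QuantumFieldTheory.Balaban1983to89.B1Eq324BenfattoKernelSect5FreeStep
import Literature.MathematicalPhysics.QuantumFieldTheory.Balaban1983to89.B1Eq324BenfattoSect5CollectErrors
import HarnessLib

/-!
# `Balaban1983to89.B1Eq324BenfattoKernelSect5CollectErrors` — [BenfattoEtAl1978] §5 p. 159, «Collecting all the errors made in this process (4.7) is proven»,
# FOR THE GAUSSIAN FIELD OF A GENERAL KERNEL: the cumulant telescope of the displaced pavement chain in DRIFTING FRAMES (the frame-`k` cumulants live
# under `𝒩(0, K(·+σ_k, ·+σ_k))` — covariance, not invariance), and (4.7) for one choice of everything ASSEMBLED from the class chain's inequality,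
# the per-step identifications and an error ledger — all three taken as displayed real-number hypotheses

statement-level skeleton of published theorems with citation tags; proofs where landed; nothing here is a claim about the
Yang–Mills mass gap

WHY THIS MODULE (cell `pub-ymgap`, seat `dag-n08-c` gen 31; node N08 [Balaban1985UV3]; the [BenfattoEtAl1978] source chain behind the (α)-row `h324`;
the ASSEMBLY layer over the class chain — structural S8 of `N08-PORT-MAP-STRUCTURAL-SIDE.md`).  My concrete `…Sect5CollectErrors.ineq47_of_chain` turns the
lower pavement chain of `…Sect5PavementChain` into (4.7) modulo two displayed obligations, the per-step identification (O1) and the ledger (O2), using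
the free field `P̂₀` twice: the chain itself and the TRANSLATION INVARIANCE of the free cumulants across the frames
(`…Sect5PavementChain.cumulantSum_chain_telescope`).  On the class road the chain is seat n08-d's `…KernelSect5PavementChain.lowerPavementChain(_appendixA)`
(p617701) under the class kernel `K`, whose frame-`k` step integrates against `𝒩(0, K(·+σ_{k+1}, ·+σ_{k+1}))` (`σ_0 = 0`, `σ_{k+1} = σ_k − τ_k`), and the
cumulants are COVARIANT: `Ê^T_{μ_G}(H^{A(·−τ)}_{J+τ}) = Ê^T_{μ_{G(·+τ,·+τ)}}(H^A_J)` (seat n08-b `…KernelSect5FreeStep.cumulantSum_hamiltonian_frame_kernel`,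
p610935).  This file (§1) re-proves the telescope for the drifting frame kernels — the frame-`k+1` cumulant of the translated step-`k` Hamiltonian IS the
frame-`k` cumulant of the step-`k` Hamiltonian — and (§2) assembles (4.7) for `𝒩(0,K)` from THREE DISPLAYED REAL-NUMBER HYPOTHESES: the chain inequality
`exp(Σ_k(Σ_□ℓ_k(□) − c_k) − a_A) ≤ ∫Π_Δχ̂ e^{H^{A_0}_{J_0}} dμ_K` (n08-d's conclusion, `c_k` its structural cost `err₅₁₁ + err₅₃₄ + 2P_k`, `a_A` the
Appendix-A exponent), the identifications `hE` (my `…KernelSect5StepBound.exists_lower_step` per frame member) and a ledger `Σ_k(c_k + idErr_k) + a_A ≤ E_tot`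
(print: `E_tot = |I|·errTerm`).  Keeping the chain as a hypothesis decouples this file from the chain's binder list; the knit composes the three.

DICTIONARY.  Frame kernels `G_k = fun x y => K (x + σ k) (y + σ k)`; step-`k` datum `(J_k, A_k)` with `J_{k+1} = (J_k + τ_k) ∩ Γ̄₁(B_k)`,
`A_{k+1} = (A_k(·−τ_k))|_{Γ̄₁(B_k)}`, `σ_{k+1} = σ_k − τ_k`; `cumulantSum μ H t = Σ_{j≤t}Ê^T_μ(H;j)/j!`.

WHAT IS PROVED (theorems only; no definition, no named fact, no `sorry`; axioms standard).
* §1 `frameKernel_translate` (`G_{k+1}(·+τ_k, ·+τ_k) = G_k`), ★ `cumulantSum_chain_telescope_kernel`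
  (`Σ_{k<n}[cS_{G_{k+1}}(H^{A_k(·−τ_k)}_{J_k+τ_k}) − cS_{G_{k+1}}(H^{A_k(·−τ_k)}_{Γ̄₁(B_k)})] = cS_{G_0}(H^{A_0}_{J_0}) − cS_{G_n}(H^{A_n}_{J_n})`),
  `cumulantSum_chain_telescope_kernel_of_eq_empty` (`J_n = ∅` ⇒ `= cS_K(H^{A_0}_{J_0})`).
* §2 ★★★ `exp_cumulantSum_sub_le_integral_of_chain` — (4.7) FOR `𝒩(0,K)`, one choice of everything: `exp(cumulantSum μ_K H^A_{J_0} t − E_tot) ≤ ∫Π_Δχ̂^{I_0}_{b_0} e^{H^A_{J_0}} dμ_K`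
  from the chain inequality, `hE`, the ledger, `J_n = ∅`, and the clip `H^{A_0}_R = H^A_R` (`R ⊆ J_0`).
* §3 (v1.1) ★★ `le_exp_cumulantSum_add_of_chain` — (4.6)'s bracket for `𝒩(0,K)`: `LHS ≤ exp(cumulantSum μ_K H^A_{J_0} t + E_tot)` from the upper chain
  inequality `LHS ≤ exp(Σ_k(c_k + Σ_□u_k))`, the upper identifications and a ledger (left side abstract).

HONEST SCOPE / NOT HERE.  The three hypotheses are discharged elsewhere (chain: n08-d S8a; identifications: `…KernelSect5StepBound` + n08-w5's depth rows per frame;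
ledger: the class edition of `…Sect5ErrTermLedger`/`…LedgerDischarge*`, to come); one self-located piece of an UNCOMMISSIONED port (plan g81 (II), START-LIST v11
§n08) — nothing chained; no generalised Basic Lemma is stated (this is (4.7)'s SHAPE for one choice of constants, modulo displayed inputs); nothing of
[Balaban1985UV3] is asserted; count-neutral for N08; nothing about d = 4, the continuum, OS axioms, a mass gap or the Clay problem.
-/

noncomputable section

open MeasureTheory ProbabilityTheory Finset
open scoped BigOperators Nat

namespace Literature.MathematicalPhysics.QuantumFieldTheory.Balaban1983to89.B1Eq324BenfattoKernelSect5CollectErrors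

open _root_.MeasureTheory _root_.ProbabilityTheory
open Literature.MathematicalPhysics.QuantumFieldTheory
open Literature.MathematicalPhysics.QuantumFieldTheory.Balaban1983to89.B1Eq324BenfattoLemma
open Literature.MathematicalPhysics.QuantumFieldTheory.Balaban1983to89.B1Eq324BenfattoSect5Boxes
open Literature.MathematicalPhysics.QuantumFieldTheory.Balaban1983to89.B1Eq324BenfattoSect5Eq511
open Literature.MathematicalPhysics.QuantumFieldTheory.Balaban1983to89.B1Eq324BenfattoSect5Eq534
open Literature.MathematicalPhysics.QuantumFieldTheory.Balaban1983to89.B1Eq324BenfattoSect5Iteration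
  (restrictCoef shiftCoef hamiltonian_inter_eq)
open Literature.MathematicalPhysics.QuantumFieldTheory.Balaban1983to89.B1Eq324BenfattoSect5PavementChain
  (chain_supported coefSupportedIn_frame cumulantSum_hamiltonian_restrict)
open Literature.MathematicalPhysics.QuantumFieldTheory.Balaban1983to89.B1Eq324BenfattoSect5CollectErrors (cumulantSum_congr_hamiltonian)
open Literature.MathematicalPhysics.QuantumFieldTheory.Balaban1983to89.B1Eq324BenfattoSect5Termination (hamiltonian_empty)
open Literature.MathematicalPhysics.QuantumFieldTheory.Balaban1983to89.B1Eq324BenfattoKernelSect5FreeStep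
  (cumulantSum_hamiltonian_frame_kernel isPosSemidefKernel_translate)

variable {d : ℕ}

/-! ## §1  The cumulant telescope in drifting frames -/

section Telescope

variable {K : B1Eq324BenfattoLemma.Site d → B1Eq324BenfattoLemma.Site d → ℝ} {s D : ℕ} {κ : ℝ} {L w v : ℕ}

/-- **The frame kernels compose**: with `σ_{k+1} = σ_k − τ_k`, `G_{k+1}(x + τ_k, y + τ_k) = K(x + σ_k, y + σ_k) = G_k(x, y)`.
[cite: BenfattoEtAl1978, §5 p.159 «a new pavement displaced by b²/2»] -/
theorem frameKernel_translate {σ τ : ℕ → B1Eq324BenfattoLemma.Site d} {n k : ℕ} (hrecσ : ∀ k < n, σ (k + 1) = σ k - τ k) (hk : k < n) :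
    (fun x y : B1Eq324BenfattoLemma.Site d => (fun x y : B1Eq324BenfattoLemma.Site d => K (x + σ (k + 1)) (y + σ (k + 1))) (x + τ k) (y + τ k)) =
      fun x y : B1Eq324BenfattoLemma.Site d => K (x + σ k) (y + σ k) := by
  have h : ∀ x : B1Eq324BenfattoLemma.Site d, x + τ k + σ (k + 1) = x + σ k := fun x => by
    rw [hrecσ k hk]
    abel
  funext x y
  simp only [h]

/-- **THE CUMULANT TELESCOPE OF THE DISPLACED CHAIN, DRIFTING FRAME KERNELS**: for a positive-semidefinite `K`, frame offsets `σ_0 = 0`,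
`σ_{k+1} = σ_k − τ_k`, and data obeying `J_{k+1} = (J_k + τ_k) ∩ Γ̄₁(B_k)`, `A_{k+1} = (A_k(·−τ_k))|_{Γ̄₁(B_k)}` with `A_0` supported in `J_0`,
`Σ_{k<n}[cS_{G_{k+1}}(H^{A_k(·−τ_k)}_{J_k+τ_k};t) − cS_{G_{k+1}}(H^{A_k(·−τ_k)}_{Γ̄₁(B_k)};t)] = cS_{G_0}(H^{A_0}_{J_0};t) − cS_{G_n}(H^{A_n}_{J_n};t)`,
`G_k = K(·+σ_k, ·+σ_k)` — the frame-`k+1` cumulant of the translated step-`k` Hamiltonian IS the frame-`k` cumulant of the step-`k` Hamiltonian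
(covariance, `…KernelSect5FreeStep.cumulantSum_hamiltonian_frame_kernel` + `frameKernel_translate`); the handed-on Hamiltonian is read through the
restriction as in the concrete `…Sect5PavementChain.cumulantSum_chain_telescope`. [cite: BenfattoEtAl1978, (4.7) p.152, §5 p.159] -/
theorem cumulantSum_chain_telescope_kernel (hK : IsPosSemidefKernel K)
    {Js Bs : ℕ → Finset (B1Eq324BenfattoLemma.Site d)} {as : ℕ → Coef d} {τ σ : ℕ → B1Eq324BenfattoLemma.Site d} {n : ℕ}
    (hsupp : CoefSupportedIn (as 0) (Js 0))
    (hrecJ : ∀ k < n, Js (k + 1) = (Js k).image (fun x => x + τ k) ∩ corridorsBar L w v (Bs k))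
    (hreca : ∀ k < n, as (k + 1) = restrictCoef (shiftCoef (as k) (-τ k)) (corridorsBar L w v (Bs k)))
    (hrecσ : ∀ k < n, σ (k + 1) = σ k - τ k) (t : ℕ) :
    ∑ k ∈ Finset.range n,
        (cumulantSum (gaussianFieldOfKernel fun x y => K (x + σ (k + 1)) (y + σ (k + 1)))
            (hamiltonian s D κ (shiftCoef (as k) (-τ k)) ((Js k).image fun x => x + τ k)) t
          - cumulantSum (gaussianFieldOfKernel fun x y => K (x + σ (k + 1)) (y + σ (k + 1)))
            (hamiltonian s D κ (shiftCoef (as k) (-τ k)) (corridorsBar L w v (Bs k))) t)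
      = cumulantSum (gaussianFieldOfKernel fun x y => K (x + σ 0) (y + σ 0)) (hamiltonian s D κ (as 0) (Js 0)) t
        - cumulantSum (gaussianFieldOfKernel fun x y => K (x + σ n) (y + σ n)) (hamiltonian s D κ (as n) (Js n)) t := by
  have hs := chain_supported hsupp hrecJ hreca (n := n)
  rw [← Finset.sum_range_sub' (fun k => cumulantSum (gaussianFieldOfKernel fun x y => K (x + σ k) (y + σ k))
    (hamiltonian s D κ (as k) (Js k)) t) n]
  refine Finset.sum_congr rfl fun k hk => ?_
  have hk' : k < n := Finset.mem_range.mp hk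
  have hsk : CoefSupportedIn (shiftCoef (as k) (-τ k)) ((Js k).image fun x => x + τ k) := coefSupportedIn_frame (hs k hk'.le) (τ k)
  have hGpsd : IsPosSemidefKernel (fun x y : B1Eq324BenfattoLemma.Site d => K (x + σ (k + 1)) (y + σ (k + 1))) :=
    isPosSemidefKernel_translate hK (σ (k + 1))
  have hcur : cumulantSum (gaussianFieldOfKernel fun x y => K (x + σ (k + 1)) (y + σ (k + 1)))
        (hamiltonian s D κ (shiftCoef (as k) (-τ k)) ((Js k).image fun x => x + τ k)) t
      = cumulantSum (gaussianFieldOfKernel fun x y => K (x + σ k) (y + σ k)) (hamiltonian s D κ (as k) (Js k)) t := by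
    rw [cumulantSum_hamiltonian_frame_kernel hGpsd (Js k) (τ k) t, frameKernel_translate hrecσ hk']
  have hnext : cumulantSum (gaussianFieldOfKernel fun x y => K (x + σ (k + 1)) (y + σ (k + 1)))
        (hamiltonian s D κ (shiftCoef (as k) (-τ k)) (corridorsBar L w v (Bs k))) t
      = cumulantSum (gaussianFieldOfKernel fun x y => K (x + σ (k + 1)) (y + σ (k + 1)))
        (hamiltonian s D κ (as (k + 1)) (Js (k + 1))) t := by
    rw [hreca k hk', hrecJ k hk', cumulantSum_hamiltonian_restrict _ Finset.inter_subset_right]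
    unfold cumulantSum truncatedExp
    simp only [hamiltonian_inter_eq hsk (corridorsBar L w v (Bs k)), Finset.inter_comm]
  rw [hcur, hnext]

/-- **At termination the telescope closes on (4.7)'s bracket**: if `J_n = ∅` the per-step differences add up to `cS_K(H^{A_0}_{J_0};t)` exactly
(`σ_0 = 0`; `H_∅ = 0` has vanishing cumulants under the probability measure `𝒩(0, G_n)`). [cite: BenfattoEtAl1978, (4.7) p.152, §5 p.154, p.159] -/
theorem cumulantSum_chain_telescope_kernel_of_eq_empty (hK : IsPosSemidefKernel K)
    {Js Bs : ℕ → Finset (B1Eq324BenfattoLemma.Site d)} {as : ℕ → Coef d} {τ σ : ℕ → B1Eq324BenfattoLemma.Site d} {n : ℕ}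
    (hsupp : CoefSupportedIn (as 0) (Js 0))
    (hrecJ : ∀ k < n, Js (k + 1) = (Js k).image (fun x => x + τ k) ∩ corridorsBar L w v (Bs k))
    (hreca : ∀ k < n, as (k + 1) = restrictCoef (shiftCoef (as k) (-τ k)) (corridorsBar L w v (Bs k)))
    (hσ0 : σ 0 = 0) (hrecσ : ∀ k < n, σ (k + 1) = σ k - τ k) (hJn : Js n = ∅) (t : ℕ) :
    ∑ k ∈ Finset.range n,
        (cumulantSum (gaussianFieldOfKernel fun x y => K (x + σ (k + 1)) (y + σ (k + 1)))
            (hamiltonian s D κ (shiftCoef (as k) (-τ k)) ((Js k).image fun x => x + τ k)) t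
          - cumulantSum (gaussianFieldOfKernel fun x y => K (x + σ (k + 1)) (y + σ (k + 1)))
            (hamiltonian s D κ (shiftCoef (as k) (-τ k)) (corridorsBar L w v (Bs k))) t)
      = cumulantSum (gaussianFieldOfKernel K) (hamiltonian s D κ (as 0) (Js 0)) t := by
  haveI : IsProbabilityMeasure (gaussianFieldOfKernel fun x y : B1Eq324BenfattoLemma.Site d => K (x + σ n) (y + σ n)) :=
    isProbabilityMeasure_gaussianFieldOfKernel (isPosSemidefKernel_translate hK (σ n))
  rw [cumulantSum_chain_telescope_kernel hK hsupp hrecJ hreca hrecσ t, hJn]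
  have h0 : hamiltonian s D κ (as n) (∅ : Finset (B1Eq324BenfattoLemma.Site d)) = fun _ => 0 :=
    funext fun z => hamiltonian_empty (as n) z
  have hK0 : (fun x y : B1Eq324BenfattoLemma.Site d => K (x + σ 0) (y + σ 0)) = K := by
    funext x y
    simp only [hσ0, add_zero]
  rw [h0, Literature.MathematicalPhysics.QuantumFieldTheory.Balaban1983to89.B1Eq324BenfattoSpecialisation.cumulantSum_zero, sub_zero, hK0]

end Telescope

/-! ## §2  (4.7) for `𝒩(0,K)`, one choice of everything, from the chain inequality, the identifications and a ledger -/

section Assembly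

variable {K : B1Eq324BenfattoLemma.Site d → B1Eq324BenfattoLemma.Site d → ℝ} {s D t : ℕ} {κ : ℝ} {L w v : ℕ}

/-- **(4.7) FOR THE GAUSSIAN FIELD OF A GENERAL KERNEL, ONE CHOICE OF EVERYTHING — «Collecting all the errors made in this process (4.7) is proven»**:
given (i) the class chain's inequality `exp(Σ_{k<n}(Σ_{□∈B_k}ℓ_k(□) − c_k) − a_A) ≤ ∫Π_Δχ̂^{I_0}_{b_0} e^{H^{A_0}_{J_0}} dμ_K` (seat n08-d's
`…KernelSect5PavementChain.lowerPavementChain_appendixA`, `c_k = err₅₁₁(k) + err₅₃₄(k) + 2P_k`, `a_A` the Appendix-A exponent), (ii) the per-step identifications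
`cS_{G_{k+1}}(H^{A_k(·−τ_k)}_{J_k+τ_k};t) − cS_{G_{k+1}}(H^{A_k(·−τ_k)}_{Γ̄₁(B_k)};t) − idErr_k ≤ Σ_□ℓ_k(□)` (`…KernelSect5StepBound.exists_lower_step` at the frame-`k`
member), (iii) a ledger `Σ_{k<n}(c_k + idErr_k) + a_A ≤ E_tot`, the recursions of the chain with `J_n = ∅` (print: `n = d + 1`), and the clip
`H^{A_0}_R = H^A_R` on `R ⊆ J_0`:  `exp(cumulantSum μ_K H^A_{J_0} t − E_tot) ≤ ∫Π_Δχ̂^{I_0}_{b_0} e^{H^A_{J_0}} dμ_K` — print's (4.7) at `E_tot = |I|·errTerm`.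
The class twin of `…Sect5CollectErrors.ineq47_of_chain` (whose conclusion `Ineq47` is spelled for `P̂₀`). [cite: BenfattoEtAl1978, Lemma (4.7) p.152, §5 p.159] -/
theorem exp_cumulantSum_sub_le_integral_of_chain (hK : IsPosSemidefKernel K)
    (a : Coef d) {Js Bs : ℕ → Finset (B1Eq324BenfattoLemma.Site d)} {as : ℕ → Coef d} {τ σ : ℕ → B1Eq324BenfattoLemma.Site d} {n : ℕ}
    {I : Finset (B1Eq324BenfattoLemma.Site d)} {b : ℝ}
    (hH : ∀ R : Finset (B1Eq324BenfattoLemma.Site d), R ⊆ Js 0 → ∀ z, hamiltonian s D κ (as 0) R z = hamiltonian s D κ a R z)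
    (hsupp : CoefSupportedIn (as 0) (Js 0))
    (hrecJ : ∀ k < n, Js (k + 1) = (Js k).image (fun x => x + τ k) ∩ corridorsBar L w v (Bs k))
    (hreca : ∀ k < n, as (k + 1) = restrictCoef (shiftCoef (as k) (-τ k)) (corridorsBar L w v (Bs k)))
    (hσ0 : σ 0 = 0) (hrecσ : ∀ k < n, σ (k + 1) = σ k - τ k) (hJn : Js n = ∅)
    (ℓ : ℕ → B1Eq324BenfattoLemma.Site d → ℝ) (c idErr : ℕ → ℝ) {aA Etot : ℝ}
    (hchain : Real.exp (∑ k ∈ Finset.range n, (∑ m ∈ Bs k, ℓ k m - c k) - aA) ≤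
      ∫ z, cutoffBoltzmann (hamiltonian s D κ (as 0) (Js 0)) I b z ∂gaussianFieldOfKernel K)
    (hE : ∀ k < n,
      cumulantSum (gaussianFieldOfKernel fun x y => K (x + σ (k + 1)) (y + σ (k + 1)))
          (hamiltonian s D κ (shiftCoef (as k) (-τ k)) ((Js k).image fun x => x + τ k)) t
        - cumulantSum (gaussianFieldOfKernel fun x y => K (x + σ (k + 1)) (y + σ (k + 1)))
          (hamiltonian s D κ (shiftCoef (as k) (-τ k)) (corridorsBar L w v (Bs k))) t - idErr k
        ≤ ∑ m ∈ Bs k, ℓ k m)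
    (hledger : ∑ k ∈ Finset.range n, (c k + idErr k) + aA ≤ Etot) :
    Real.exp (cumulantSum (gaussianFieldOfKernel K) (hamiltonian s D κ a (Js 0)) t - Etot) ≤
      ∫ z, cutoffBoltzmann (hamiltonian s D κ a (Js 0)) I b z ∂gaussianFieldOfKernel K := by
  -- the clip: `H^{A_0}_{J_0} = H^A_{J_0}` pointwise
  have hH0 : hamiltonian s D κ (as 0) (Js 0) = hamiltonian s D κ a (Js 0) := funext (hH (Js 0) subset_rfl)
  rw [hH0] at hchain
  -- (O1) summed over the steps and telescoped
  have hO1 : ∑ k ∈ Finset.range n,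
      (cumulantSum (gaussianFieldOfKernel fun x y => K (x + σ (k + 1)) (y + σ (k + 1)))
          (hamiltonian s D κ (shiftCoef (as k) (-τ k)) ((Js k).image fun x => x + τ k)) t
        - cumulantSum (gaussianFieldOfKernel fun x y => K (x + σ (k + 1)) (y + σ (k + 1)))
          (hamiltonian s D κ (shiftCoef (as k) (-τ k)) (corridorsBar L w v (Bs k))) t - idErr k) ≤
      ∑ k ∈ Finset.range n, ∑ m ∈ Bs k, ℓ k m :=
    Finset.sum_le_sum fun k hk => hE k (Finset.mem_range.mp hk)
  rw [Finset.sum_sub_distrib, cumulantSum_chain_telescope_kernel_of_eq_empty hK hsupp hrecJ hreca hσ0 hrecσ hJn t,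
    cumulantSum_congr_hamiltonian (gaussianFieldOfKernel K) (hH (Js 0) subset_rfl) t] at hO1
  -- split the chain's exponent
  have hsplit : ∑ k ∈ Finset.range n, (∑ m ∈ Bs k, ℓ k m - c k) =
      ∑ k ∈ Finset.range n, ∑ m ∈ Bs k, ℓ k m - ∑ k ∈ Finset.range n, c k := Finset.sum_sub_distrib _ _
  have hsum : ∑ k ∈ Finset.range n, (c k + idErr k) = ∑ k ∈ Finset.range n, c k + ∑ k ∈ Finset.range n, idErr k :=
    Finset.sum_add_distrib
  rw [hsplit] at hchain
  rw [hsum] at hledger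
  refine le_trans (Real.exp_le_exp.2 ?_) hchain
  linarith

end Assembly

/-! ## §3  (4.6)'s collection for `𝒩(0,K)`: the upper side, from the upper chain inequality, the identifications and a ledger (v1.1) -/

section AssemblyUpper

variable {K : B1Eq324BenfattoLemma.Site d → B1Eq324BenfattoLemma.Site d → ℝ} {s D t : ℕ} {κ : ℝ} {L w v : ℕ}

/-- **(4.6)'S COLLECTION OF ERRORS FOR THE GAUSSIAN FIELD OF A GENERAL KERNEL, ONE CHOICE OF EVERYTHING** (v1.1, the upper twin of
`exp_cumulantSum_sub_le_integral_of_chain`): given (i) the class UPPER chain's inequality `LHS ≤ exp(Σ_{k<n}(c_k + Σ_{□∈B_k}u_k(□)))` (seat n08-d's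
`…KernelSect5PavementChainUpper.upperPavementChainCond_le_exp`, `LHS` the conditioned (4.6)-integral, `c_k = err₅₁₁(k) + err₅₃₄(k) + 2P′_k`), (ii) the per-step
UPPER identifications `Σ_□u_k(□) ≤ cS_{G_{k+1}}(H^{A_k(·−τ_k)}_{J_k+τ_k};t) − cS_{G_{k+1}}(H^{A_k(·−τ_k)}_{Γ̄₁(B_k)};t) + idErr_k`, (iii) a ledger
`Σ_{k<n}(c_k + idErr_k) ≤ E_tot`, the recursions with `J_n = ∅` and the clip `H^{A_0}_R = H^A_R` (`R ⊆ J_0`):  `LHS ≤ exp(cumulantSum μ_K H^A_{J_0} t + E_tot)` —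
print's (4.6) bracket, the left side kept abstract (the telescope `cumulantSum_chain_telescope_kernel_of_eq_empty` does the work).  The class twin of
`…Sect5PavementChainUpper.ineq46_of_chain`'s bookkeeping. [cite: BenfattoEtAl1978, Lemma (4.6) p.152, (5.36) p.159] -/
theorem le_exp_cumulantSum_add_of_chain (hK : IsPosSemidefKernel K)
    (a : Coef d) {Js Bs : ℕ → Finset (B1Eq324BenfattoLemma.Site d)} {as : ℕ → Coef d} {τ σ : ℕ → B1Eq324BenfattoLemma.Site d} {n : ℕ}
    (hH : ∀ R : Finset (B1Eq324BenfattoLemma.Site d), R ⊆ Js 0 → ∀ z, hamiltonian s D κ (as 0) R z = hamiltonian s D κ a R z)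
    (hsupp : CoefSupportedIn (as 0) (Js 0))
    (hrecJ : ∀ k < n, Js (k + 1) = (Js k).image (fun x => x + τ k) ∩ corridorsBar L w v (Bs k))
    (hreca : ∀ k < n, as (k + 1) = restrictCoef (shiftCoef (as k) (-τ k)) (corridorsBar L w v (Bs k)))
    (hσ0 : σ 0 = 0) (hrecσ : ∀ k < n, σ (k + 1) = σ k - τ k) (hJn : Js n = ∅)
    (u : ℕ → B1Eq324BenfattoLemma.Site d → ℝ) (c idErr : ℕ → ℝ) {LHS Etot : ℝ}
    (hchain : LHS ≤ Real.exp (∑ k ∈ Finset.range n, (c k + ∑ m ∈ Bs k, u k m)))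
    (hE : ∀ k < n, ∑ m ∈ Bs k, u k m ≤
      cumulantSum (gaussianFieldOfKernel fun x y => K (x + σ (k + 1)) (y + σ (k + 1)))
          (hamiltonian s D κ (shiftCoef (as k) (-τ k)) ((Js k).image fun x => x + τ k)) t
        - cumulantSum (gaussianFieldOfKernel fun x y => K (x + σ (k + 1)) (y + σ (k + 1)))
          (hamiltonian s D κ (shiftCoef (as k) (-τ k)) (corridorsBar L w v (Bs k))) t + idErr k)
    (hledger : ∑ k ∈ Finset.range n, (c k + idErr k) ≤ Etot) :
    LHS ≤ Real.exp (cumulantSum (gaussianFieldOfKernel K) (hamiltonian s D κ a (Js 0)) t + Etot) := by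
  -- (O1) summed over the steps and telescoped, then the clip
  have hO1 : ∑ k ∈ Finset.range n, ∑ m ∈ Bs k, u k m ≤ ∑ k ∈ Finset.range n,
      (cumulantSum (gaussianFieldOfKernel fun x y => K (x + σ (k + 1)) (y + σ (k + 1)))
          (hamiltonian s D κ (shiftCoef (as k) (-τ k)) ((Js k).image fun x => x + τ k)) t
        - cumulantSum (gaussianFieldOfKernel fun x y => K (x + σ (k + 1)) (y + σ (k + 1)))
          (hamiltonian s D κ (shiftCoef (as k) (-τ k)) (corridorsBar L w v (Bs k))) t + idErr k) :=
    Finset.sum_le_sum fun k hk => hE k (Finset.mem_range.mp hk)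
  rw [Finset.sum_add_distrib, cumulantSum_chain_telescope_kernel_of_eq_empty hK hsupp hrecJ hreca hσ0 hrecσ hJn t,
    cumulantSum_congr_hamiltonian (gaussianFieldOfKernel K) (hH (Js 0) subset_rfl) t] at hO1
  -- split the chain's exponent and compare
  have hsplit : ∑ k ∈ Finset.range n, (c k + ∑ m ∈ Bs k, u k m) =
      ∑ k ∈ Finset.range n, c k + ∑ k ∈ Finset.range n, ∑ m ∈ Bs k, u k m := Finset.sum_add_distrib
  have hsum : ∑ k ∈ Finset.range n, (c k + idErr k) = ∑ k ∈ Finset.range n, c k + ∑ k ∈ Finset.range n, idErr k :=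
    Finset.sum_add_distrib
  rw [hsplit] at hchain
  rw [hsum] at hledger
  refine hchain.trans (Real.exp_le_exp.2 ?_)
  linarith

end AssemblyUpper

end Literature.MathematicalPhysics.QuantumFieldTheory.Balaban1983to89.B1Eq324BenfattoKernelSect5CollectErrors

end
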